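import Literature.Geometry.Manifold.FramedCharts
import Mathlib.Analysis.Calculus.BumpFunction.InnerProduct
import Mathlib.Analysis.Calculus.BumpFunction.FiniteDimension
import HarnessLib

/-!
# Patch systems on a compact manifold: finitely many framed charts with nested cut-offs and a
# subordinate partition of unity (topic `Geometry/Manifold`)

Geometric layer of the programme to prove short-time existence for quasilinear strictly
parabolic systems on a closed manifold (hypothesis `hQL` of
`Literature.Geometry.Riemannian.ricciFlow_shortTime_existence_of_quasilinear`). The a priori
estimates and the iteration of that programme are localised by a FIXED finite family of framed
charts (`FramedChart`, `FramedCharts.lean`) with nested cut-offs; this file packages such a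
family:

* `FramedChart.globalize` — zero-extension to `M` of a function on the model supported in the
  target of a framed chart, and the smoothness of all its chart expressions
  (`contDiffOn_globalize_comp_inv`);
* `PatchSystem` — finitely many framed charts `κₚ` with radii `rₚ > 0`,
  `closedBall 0 (4rₚ) ⊆ κₚ.target`, whose inner balls `{κₚ x ∈ ball 0 rₚ}` cover `M`;
* its cut-offs on the model: `bump p` (`= 1` on `closedBall 0 rₚ`, support `ball 0 (2rₚ)`),
  `cut p` (`= 1` on `closedBall 0 (2rₚ)`, support `ball 0 (3rₚ)`), `cutPlus p`
  (`= 1` on `closedBall 0 (3rₚ)`, support `ball 0 (4rₚ)`), and the partition of unity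
  `ρ p = bumpM p / Σ bumpM` on `M` (`sum_rho`, support inside the region where `cut p ∘ κₚ = 1`,
  smooth chart expressions `contDiffOn_rho_comp_inv`);
* `exists_patchSystem` — on a compact boundaryless manifold, for prescribed frames
  `A : M → (E ≃L[ℝ] E')` and prescribed fineness `δ : M → ℝ_{>0}` there is a patch system whose
  charts are based at points `z` with frame `A z` (recentred at `z`) and radii `≤ δ z`.

Everything is proved; no named fact and no `sorry` is introduced.

## References

* J. M. Lee, *Introduction to Smooth Manifolds*, 2nd ed., Springer 2013, Ch. 2 (bump functions,
  partitions of unity, Thm. 2.23). [Lee2013]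
-/

noncomputable section

open Set Function Filter Topology Metric
open scoped Manifold ContDiff Topology

namespace Literature.Geometry.Manifold

variable {E : Type*} [NormedAddCommGroup E] [NormedSpace ℝ E] {H : Type*} [TopologicalSpace H]
variable {I : ModelWithCorners ℝ E H} {M : Type*} [TopologicalSpace M] [ChartedSpace H M]
variable {E' : Type*} [NormedAddCommGroup E'] [NormedSpace ℝ E']
variable {F : Type*} [NormedAddCommGroup F]

namespace FramedChart

variable (κ κ' : FramedChart I M E')

/-! ### Zero-extension of functions on the model to the manifold -/

open Classical in
/-- **Globalisation**: the zero-extension to `M` of `g ∘ κ.map` (for a function `g` on the model,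
typically supported inside `κ.target`). [cite: Lee2013, Ch. 2] -/
def globalize (g : E' → F) (x : M) : F := if x ∈ κ.source then g (κ.map x) else 0

/-- `globalize_of_mem`: globalize of mem. [folklore] -/
theorem globalize_of_mem {g : E' → F} {x : M} (hx : x ∈ κ.source) :
    κ.globalize g x = g (κ.map x) := by
  simp [globalize, hx]

/-- `globalize_of_notMem`: globalize of notMem. [folklore] -/
theorem globalize_of_notMem {g : E' → F} {x : M} (hx : x ∉ κ.source) : κ.globalize g x = 0 := by
  simp [globalize, hx]

/-- In its own chart the globalisation is `g`. [folklore] -/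
theorem globalize_inv {g : E' → F} {y : E'} (hy : y ∈ κ.target) :
    κ.globalize g (κ.inv y) = g y := by
  rw [κ.globalize_of_mem (κ.inv_mem_source hy), κ.map_inv hy]

/-- The globalisation vanishes outside `κ.inv '' tsupport g` (for `tsupport g ⊆ κ.target`).
[folklore] -/
theorem globalize_eq_zero {g : E' → F} {x : M} (hx : x ∉ κ.source ∩ κ.map ⁻¹' tsupport g) :
    κ.globalize g x = 0 := by
  by_cases hs : x ∈ κ.source
  · rw [κ.globalize_of_mem hs]
    exact image_eq_zero_of_notMem_tsupport fun h ↦ hx ⟨hs, h⟩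
  · exact κ.globalize_of_notMem hs

/-- `globalize_smul`: globalize smul. [folklore] -/
theorem globalize_smul [NormedSpace ℝ F] (a : E' → ℝ) (g : E' → F) (x : M) :
    κ.globalize (fun y ↦ a y • g y) x = κ.globalize a x • κ.globalize g x := by
  by_cases hx : x ∈ κ.source
  · simp [globalize, hx]
  · simp [globalize, hx]

/-- **Chart expressions of a globalisation are smooth**: if `g` is smooth on `κ.target` with
`tsupport g ⊆ K`, `K` compact, `K ⊆ κ.target`, then `κ.globalize g ∘ κ'.inv` is smooth on
`κ'.target` for every framed chart `κ'`. [cite: Lee2013, Ch. 2] -/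
theorem contDiffOn_globalize_comp_inv [NormedSpace ℝ F] [IsManifold I ∞ M] [I.Boundaryless]
    [T2Space M] {g : E' → F} (hg : ContDiffOn ℝ ∞ g κ.target) {K : Set E'} (hK : IsCompact K)
    (hKt : K ⊆ κ.target) (hgK : tsupport g ⊆ K) :
    ContDiffOn ℝ ∞ (κ.globalize g ∘ κ'.inv) κ'.target := by
  intro y hy
  -- the compact set off which the globalisation vanishes, seen in `M`
  obtain ⟨hKc, hKs⟩ := κ.isCompact_image_inv hK hKt
  have hKcl : IsClosed (κ.inv '' K) := hKc.isClosed
  by_cases hys : κ'.inv y ∈ κ.source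
  · -- on the overlap the chart expression is `g ∘ transition`
    have hyo : y ∈ κ'.overlap κ := (κ'.mem_overlap_iff κ).2 ⟨hy, hys⟩
    have hO := κ'.isOpen_overlap κ
    have hsm : ContDiffOn ℝ ∞ (g ∘ κ'.transition κ) (κ'.overlap κ) :=
      hg.comp (κ'.contDiffOn_transition κ) fun y₁ hy₁ ↦
        κ.overlap_subset_target κ' (κ'.transition_mem_overlap κ hy₁)
    have heq : EqOn (κ.globalize g ∘ κ'.inv) (g ∘ κ'.transition κ) (κ'.overlap κ) := by
      intro y₁ hy₁
      obtain ⟨_, hy₁s⟩ := (κ'.mem_overlap_iff κ).1 hy₁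
      simp only [comp_apply, transition_apply]
      exact κ.globalize_of_mem hy₁s
    have h1 : ContDiffAt ℝ ∞ (g ∘ κ'.transition κ) y := hsm.contDiffAt (hO.mem_nhds hyo)
    exact (h1.congr_of_eventuallyEq (eventuallyEq_of_mem (hO.mem_nhds hyo) heq)).contDiffWithinAt
  · -- off the source of `κ` the globalisation vanishes near `κ'.inv y`
    have hyK : κ'.inv y ∉ κ.inv '' K := fun h ↦ hys (hKs h)
    have hU : IsOpen (κ'.target ∩ κ'.inv ⁻¹' (κ.inv '' K)ᶜ) :=
      κ'.continuousOn_inv.isOpen_inter_preimage κ'.isOpen_target hKcl.isOpen_compl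
    have hyU : y ∈ κ'.target ∩ κ'.inv ⁻¹' (κ.inv '' K)ᶜ := ⟨hy, hyK⟩
    have hzero : EqOn (κ.globalize g ∘ κ'.inv) (fun _ ↦ 0)
        (κ'.target ∩ κ'.inv ⁻¹' (κ.inv '' K)ᶜ) := by
      intro y₁ hy₁
      simp only [comp_apply]
      refine κ.globalize_eq_zero fun h ↦ hy₁.2 ?_
      rw [κ.image_inv_eq hKt]
      exact ⟨h.1, hgK h.2⟩
    have h1 : ContDiffAt ℝ ∞ (fun _ : E' ↦ (0 : F)) y := contDiffAt_const
    exact (h1.congr_of_eventuallyEq (eventuallyEq_of_mem (hU.mem_nhds hyU) hzero)).contDiffWithinAt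

end FramedChart

/-- A globalisation multiplied by a second globalisation of the same chart. [folklore] -/
theorem FramedChart.globalize_mul (κ : FramedChart I M E') (a g : E' → ℝ) (x : M) :
    κ.globalize (fun y ↦ a y * g y) x = κ.globalize a x * κ.globalize g x := by
  by_cases hx : x ∈ κ.source
  · simp [FramedChart.globalize, hx]
  · simp [FramedChart.globalize, hx]

/-! ### Patch systems -/

/-- **A patch system**: finitely many framed charts `κₚ` (indexed by a finite type `ι`) with
radii `rₚ > 0` such that `closedBall 0 (4 rₚ) ⊆ κₚ.target` (room for three nested cut-offs)
and such that the inner regions `{x ∈ κₚ.source | κₚ.map x ∈ ball 0 rₚ}` cover `M`.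
[cite: Lee2013, Thm. 2.23] -/
structure PatchSystem (I : ModelWithCorners ℝ E H) (M : Type*) [TopologicalSpace M]
    [ChartedSpace H M] (E' : Type*) [NormedAddCommGroup E'] [NormedSpace ℝ E'] (ι : Type*)
    [Fintype ι] where
  /-- the framed charts -/
  chart : ι → FramedChart I M E'
  /-- the radii -/
  r : ι → ℝ
  r_pos : ∀ p, 0 < r p
  closedBall_subset : ∀ p, closedBall (0 : E') (4 * r p) ⊆ (chart p).target
  cover : ∀ x : M, ∃ p, x ∈ (chart p).source ∧ (chart p).map x ∈ ball (0 : E') (r p)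

namespace PatchSystem

variable {ι : Type*} [Fintype ι] (P : PatchSystem I M E' ι)

/-- The ball of radius `k rₚ` lies in the target for `k ≤ 4`. [folklore] -/
theorem ball_subset_target (p : ι) {k : ℝ} (hk : k ≤ 4) : ball (0 : E') (k * P.r p) ⊆ (P.chart p).target :=
  (ball_subset_closedBall.trans (closedBall_subset_closedBall
    (mul_le_mul_of_nonneg_right hk (P.r_pos p).le))).trans (P.closedBall_subset p)

/-- `closedBall_subset_target`: closedBall subset target. [folklore] -/
theorem closedBall_subset_target (p : ι) {k : ℝ} (hk : k ≤ 4) :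
    closedBall (0 : E') (k * P.r p) ⊆ (P.chart p).target :=
  (closedBall_subset_closedBall (mul_le_mul_of_nonneg_right hk (P.r_pos p).le)).trans
    (P.closedBall_subset p)

section Cutoffs

/-- A bump on the model centred at `0` with inner radius `a rₚ` and outer radius `b rₚ`
(`0 < a < b`). [cite: Lee2013, Ch. 2] -/
def bumpOf (p : ι) (a b : ℝ) (ha : 0 < a) (hab : a < b) : ContDiffBump (0 : E') where
  rIn := a * P.r p
  rOut := b * P.r p
  rIn_pos := mul_pos ha (P.r_pos p)
  rIn_lt_rOut := mul_lt_mul_of_pos_right hab (P.r_pos p)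

/-- The partition bump: `= 1` on `closedBall 0 rₚ`, support `ball 0 (2rₚ)`. [cite: Lee2013, Ch. 2] -/
def bump (p : ι) : ContDiffBump (0 : E') := P.bumpOf p 1 2 one_pos one_lt_two

/-- The cut-off: `= 1` on `closedBall 0 (2rₚ)`, support `ball 0 (3rₚ)`. [cite: Lee2013, Ch. 2] -/
def cut (p : ι) : ContDiffBump (0 : E') := P.bumpOf p 2 3 two_pos (by norm_num)

/-- The outer cut-off: `= 1` on `closedBall 0 (3rₚ)`, support `ball 0 (4rₚ)`.
[cite: Lee2013, Ch. 2] -/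
def cutPlus (p : ι) : ContDiffBump (0 : E') := P.bumpOf p 3 4 three_pos (by norm_num)

/-- `bump_rIn`: bump rIn. [folklore] -/
@[simp] theorem bump_rIn (p : ι) : (P.bump p).rIn = 1 * P.r p := rfl
/-- `bump_rOut`: bump rOut. [folklore] -/
@[simp] theorem bump_rOut (p : ι) : (P.bump p).rOut = 2 * P.r p := rfl
/-- `cut_rIn`: cut rIn. [folklore] -/
@[simp] theorem cut_rIn (p : ι) : (P.cut p).rIn = 2 * P.r p := rfl
/-- `cut_rOut`: cut rOut. [folklore] -/
@[simp] theorem cut_rOut (p : ι) : (P.cut p).rOut = 3 * P.r p := rfl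
/-- `cutPlus_rIn`: cutPlus rIn. [folklore] -/
@[simp] theorem cutPlus_rIn (p : ι) : (P.cutPlus p).rIn = 3 * P.r p := rfl
/-- `cutPlus_rOut`: cutPlus rOut. [folklore] -/
@[simp] theorem cutPlus_rOut (p : ι) : (P.cutPlus p).rOut = 4 * P.r p := rfl

variable [HasContDiffBump E']

/-- The supports of the three cut-offs lie in the target. [folklore] -/
theorem tsupport_bump_subset (p : ι) : tsupport (P.bump p) ⊆ (P.chart p).target := by
  rw [ContDiffBump.tsupport_eq, bump_rOut]
  exact P.closedBall_subset_target p (by norm_num)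

/-- `tsupport_cut_subset`: tsupport cut subset. [folklore] -/
theorem tsupport_cut_subset (p : ι) : tsupport (P.cut p) ⊆ (P.chart p).target := by
  rw [ContDiffBump.tsupport_eq, cut_rOut]
  exact P.closedBall_subset_target p (by norm_num)

/-- `tsupport_cutPlus_subset`: tsupport cutPlus subset. [folklore] -/
theorem tsupport_cutPlus_subset (p : ι) : tsupport (P.cutPlus p) ⊆ (P.chart p).target := by
  rw [ContDiffBump.tsupport_eq, cutPlus_rOut]
  exact P.closedBall_subset_target p le_rfl

/-- `cut = 1` on the support of `bump`. [folklore] -/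
theorem cut_eq_one_of_mem_tsupport_bump (p : ι) {y : E'} (hy : y ∈ tsupport (P.bump p)) :
    P.cut p y = 1 := by
  rw [ContDiffBump.tsupport_eq, bump_rOut] at hy
  exact (P.cut p).one_of_mem_closedBall (by rwa [cut_rIn])

/-- `cutPlus = 1` on the support of `cut`. [folklore] -/
theorem cutPlus_eq_one_of_mem_tsupport_cut (p : ι) {y : E'} (hy : y ∈ tsupport (P.cut p)) :
    P.cutPlus p y = 1 := by
  rw [ContDiffBump.tsupport_eq, cut_rOut] at hy
  exact (P.cutPlus p).one_of_mem_closedBall (by rwa [cutPlus_rIn])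

/-- `cut_mul_bump`: cut mul bump. [folklore] -/
theorem cut_mul_bump (p : ι) (y : E') : P.cut p y * P.bump p y = P.bump p y := by
  by_cases hy : y ∈ tsupport (P.bump p)
  · rw [P.cut_eq_one_of_mem_tsupport_bump p hy, one_mul]
  · rw [image_eq_zero_of_notMem_tsupport hy, mul_zero]

/-- `cutPlus_mul_cut`: cutPlus mul cut. [folklore] -/
theorem cutPlus_mul_cut (p : ι) (y : E') : P.cutPlus p y * P.cut p y = P.cut p y := by
  by_cases hy : y ∈ tsupport (P.cut p)
  · rw [P.cutPlus_eq_one_of_mem_tsupport_cut p hy, one_mul]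
  · rw [image_eq_zero_of_notMem_tsupport hy, mul_zero]

/-! ### The partition of unity -/

/-- The partition bumps on `M`. [cite: Lee2013, Thm. 2.23] -/
def bumpM (p : ι) : M → ℝ := (P.chart p).globalize (P.bump p)

/-- Their sum. [cite: Lee2013, Thm. 2.23] -/
def bumpSum (x : M) : ℝ := ∑ p, P.bumpM p x

/-- `bumpM_nonneg`: bumpM nonneg. [folklore] -/
theorem bumpM_nonneg (p : ι) (x : M) : 0 ≤ P.bumpM p x := by
  by_cases hx : x ∈ (P.chart p).source
  · rw [bumpM, FramedChart.globalize_of_mem _ hx]; exact (P.bump p).nonneg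
  · rw [bumpM, FramedChart.globalize_of_notMem _ hx]

/-- `bumpM_le_one`: bumpM le one. [folklore] -/
theorem bumpM_le_one (p : ι) (x : M) : P.bumpM p x ≤ 1 := by
  by_cases hx : x ∈ (P.chart p).source
  · rw [bumpM, FramedChart.globalize_of_mem _ hx]; exact (P.bump p).le_one
  · rw [bumpM, FramedChart.globalize_of_notMem _ hx]; exact zero_le_one

/-- At every point one of the partition bumps equals `1` (the inner balls cover). [folklore] -/
theorem exists_bumpM_eq_one (x : M) : ∃ p, P.bumpM p x = 1 := by
  obtain ⟨p, hx, hb⟩ := P.cover x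
  refine ⟨p, ?_⟩
  rw [bumpM, FramedChart.globalize_of_mem _ hx]
  exact (P.bump p).one_of_mem_closedBall (ball_subset_closedBall (by simpa using hb))

/-- The sum of the partition bumps is at least `1`, in particular positive. [folklore] -/
theorem one_le_bumpSum (x : M) : 1 ≤ P.bumpSum x := by
  obtain ⟨p, hp⟩ := P.exists_bumpM_eq_one x
  rw [bumpSum, ← hp]
  exact Finset.single_le_sum (f := fun q ↦ P.bumpM q x) (fun q _ ↦ P.bumpM_nonneg q x)
    (Finset.mem_univ p)

/-- `bumpSum_pos`: bumpSum pos. [folklore] -/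
theorem bumpSum_pos (x : M) : 0 < P.bumpSum x := one_pos.trans_le (P.one_le_bumpSum x)

/-- **The partition of unity** `ρₚ = bumpM p / Σ_q bumpM q`. [cite: Lee2013, Thm. 2.23] -/
def rho (p : ι) (x : M) : ℝ := P.bumpM p x / P.bumpSum x

/-- `rho_nonneg`: rho nonneg. [folklore] -/
theorem rho_nonneg (p : ι) (x : M) : 0 ≤ P.rho p x :=
  div_nonneg (P.bumpM_nonneg p x) (P.bumpSum_pos x).le

/-- `rho_le_one`: rho le one. [folklore] -/
theorem rho_le_one (p : ι) (x : M) : P.rho p x ≤ 1 := by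
  rw [rho, div_le_one (P.bumpSum_pos x)]
  exact Finset.single_le_sum (f := fun q ↦ P.bumpM q x) (fun q _ ↦ P.bumpM_nonneg q x)
    (Finset.mem_univ p)

/-- **`Σₚ ρₚ = 1`.** [cite: Lee2013, Thm. 2.23] -/
theorem sum_rho (x : M) : ∑ p, P.rho p x = 1 := by
  simp only [rho, div_eq_mul_inv]
  rw [← Finset.sum_mul]
  exact mul_inv_cancel₀ (P.bumpSum_pos x).ne'

/-- `ρₚ` vanishes off the source of its chart. [folklore] -/
theorem rho_eq_zero_of_notMem (p : ι) {x : M} (hx : x ∉ (P.chart p).source) : P.rho p x = 0 := by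
  rw [rho, bumpM, FramedChart.globalize_of_notMem _ hx, zero_div]

/-- Where `ρₚ ≠ 0`, the point is in the source and is charted into the support of the bump.
[folklore] -/
theorem mem_of_rho_ne_zero (p : ι) {x : M} (hx : P.rho p x ≠ 0) :
    x ∈ (P.chart p).source ∧ (P.chart p).map x ∈ ball (0 : E') (2 * P.r p) := by
  by_cases hs : x ∈ (P.chart p).source
  · refine ⟨hs, ?_⟩
    have h : P.bump p ((P.chart p).map x) ≠ 0 := by
      intro h0
      apply hx
      rw [rho, bumpM, FramedChart.globalize_of_mem _ hs, h0, zero_div]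
    have h' := Function.mem_support.2 h
    rwa [ContDiffBump.support_eq, bump_rOut] at h'
  · exact absurd (P.rho_eq_zero_of_notMem p hs) hx

/-- `cut ∘ map = 1` wherever `ρₚ ≠ 0`: `ρₚ` is supported in the unit region of the cut-off.
[folklore] -/
theorem cut_map_eq_one_of_rho_ne_zero (p : ι) {x : M} (hx : P.rho p x ≠ 0) :
    P.cut p ((P.chart p).map x) = 1 := by
  obtain ⟨_, hb⟩ := P.mem_of_rho_ne_zero p hx
  exact (P.cut p).one_of_mem_closedBall (ball_subset_closedBall (by rwa [cut_rIn]))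

/-- `ρₚ · (cut ∘ map) = ρₚ` (as globalised functions). [folklore] -/
theorem rho_mul_globalize_cut (p : ι) (x : M) :
    P.rho p x * (P.chart p).globalize (P.cut p) x = P.rho p x := by
  by_cases hx : P.rho p x = 0
  · rw [hx, zero_mul]
  · obtain ⟨hs, _⟩ := P.mem_of_rho_ne_zero p hx
    rw [FramedChart.globalize_of_mem _ hs, P.cut_map_eq_one_of_rho_ne_zero p hx, mul_one]

/-- **Chart expressions of the partition functions are smooth.** [cite: Lee2013, Thm. 2.23] -/
theorem contDiffOn_bumpM_comp_inv [IsManifold I ∞ M] [I.Boundaryless] [T2Space M]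
    [FiniteDimensional ℝ E'] (p q : ι) :
    ContDiffOn ℝ ∞ (P.bumpM p ∘ (P.chart q).inv) (P.chart q).target :=
  (P.chart p).contDiffOn_globalize_comp_inv (P.chart q) (P.bump p).contDiff.contDiffOn
    (isCompact_closedBall (0 : E') (4 * P.r p)) (P.closedBall_subset p) (by
      rw [ContDiffBump.tsupport_eq, bump_rOut]
      exact closedBall_subset_closedBall (by nlinarith [P.r_pos p]))

/-- `contDiffOn_bumpSum_comp_inv`: contDiffOn bumpSum comp inv. [folklore] -/
theorem contDiffOn_bumpSum_comp_inv [IsManifold I ∞ M] [I.Boundaryless] [T2Space M]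
    [FiniteDimensional ℝ E'] (q : ι) :
    ContDiffOn ℝ ∞ (P.bumpSum ∘ (P.chart q).inv) (P.chart q).target := by
  have h : P.bumpSum ∘ (P.chart q).inv = fun y ↦ ∑ p, (P.bumpM p ∘ (P.chart q).inv) y := by
    funext y; simp [bumpSum]
  rw [h]
  exact ContDiffOn.sum fun p _ ↦ P.contDiffOn_bumpM_comp_inv p q

/-- `contDiffOn_rho_comp_inv`: contDiffOn rho comp inv. [folklore] -/
theorem contDiffOn_rho_comp_inv [IsManifold I ∞ M] [I.Boundaryless] [T2Space M]
    [FiniteDimensional ℝ E'] (p q : ι) :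
    ContDiffOn ℝ ∞ (P.rho p ∘ (P.chart q).inv) (P.chart q).target := by
  have h : P.rho p ∘ (P.chart q).inv =
      fun y ↦ (P.bumpM p ∘ (P.chart q).inv) y / (P.bumpSum ∘ (P.chart q).inv) y := by
    funext y; simp [rho]
  rw [h]
  exact (P.contDiffOn_bumpM_comp_inv p q).div (P.contDiffOn_bumpSum_comp_inv q)
    fun y _ ↦ (P.bumpSum_pos _).ne'

/-- Chart expressions of the globalised cut-offs are smooth. [cite: Lee2013, Ch. 2] -/
theorem contDiffOn_globalize_cut_comp_inv [IsManifold I ∞ M] [I.Boundaryless] [T2Space M]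
    [FiniteDimensional ℝ E'] (p q : ι) :
    ContDiffOn ℝ ∞ ((P.chart p).globalize (P.cut p) ∘ (P.chart q).inv) (P.chart q).target :=
  (P.chart p).contDiffOn_globalize_comp_inv (P.chart q) (P.cut p).contDiff.contDiffOn
    (isCompact_closedBall (0 : E') (4 * P.r p)) (P.closedBall_subset p) (by
      rw [ContDiffBump.tsupport_eq, cut_rOut]
      exact closedBall_subset_closedBall (by nlinarith [P.r_pos p]))

/-- `contDiffOn_globalize_cutPlus_comp_inv`: contDiffOn globalize cutPlus comp inv. [folklore] -/
theorem contDiffOn_globalize_cutPlus_comp_inv [IsManifold I ∞ M] [I.Boundaryless] [T2Space M]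
    [FiniteDimensional ℝ E'] (p q : ι) :
    ContDiffOn ℝ ∞ ((P.chart p).globalize (P.cutPlus p) ∘ (P.chart q).inv)
      (P.chart q).target :=
  (P.chart p).contDiffOn_globalize_comp_inv (P.chart q) (P.cutPlus p).contDiff.contDiffOn
    (isCompact_closedBall (0 : E') (4 * P.r p)) (P.closedBall_subset p) (by
      rw [ContDiffBump.tsupport_eq, cutPlus_rOut])

/-! ### The own-chart expression of the partition function -/

open Classical in
/-- The own-chart expression of `ρₚ`, zero-extended to the model. [cite: Lee2013, Thm. 2.23] -/
def rhoHat (p : ι) (y : E') : ℝ := if y ∈ (P.chart p).target then P.rho p ((P.chart p).inv y) else 0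

/-- `rhoHat_of_mem`: rhoHat of mem. [folklore] -/
theorem rhoHat_of_mem (p : ι) {y : E'} (hy : y ∈ (P.chart p).target) :
    P.rhoHat p y = P.rho p ((P.chart p).inv y) := by
  simp [rhoHat, hy]

/-- `rhoHat_map`: rhoHat map. [folklore] -/
theorem rhoHat_map (p : ι) {x : M} (hx : x ∈ (P.chart p).source) :
    P.rhoHat p ((P.chart p).map x) = P.rho p x := by
  rw [P.rhoHat_of_mem p ((P.chart p).map_mem_target hx), (P.chart p).inv_map hx]

/-- `rhoHat p` vanishes off `ball 0 (2rₚ)`. [folklore] -/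
theorem rhoHat_eq_zero (p : ι) {y : E'} (hy : y ∉ ball (0 : E') (2 * P.r p)) : P.rhoHat p y = 0 := by
  by_cases hyt : y ∈ (P.chart p).target
  · rw [P.rhoHat_of_mem p hyt]
    by_contra h
    obtain ⟨_, hb⟩ := P.mem_of_rho_ne_zero p h
    rw [(P.chart p).map_inv hyt] at hb
    exact hy hb
  · simp [rhoHat, hyt]

/-- `tsupport_rhoHat_subset`: tsupport rhoHat subset. [folklore] -/
theorem tsupport_rhoHat_subset (p : ι) : tsupport (P.rhoHat p) ⊆ closedBall (0 : E') (2 * P.r p) := by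
  rw [← closure_ball (0 : E') (mul_pos two_pos (P.r_pos p)).ne']
  refine closure_mono fun y hy ↦ ?_
  by_contra h
  exact hy (P.rhoHat_eq_zero p h)

/-- **The own-chart expression of `ρₚ` is smooth on the model.** [cite: Lee2013, Thm. 2.23] -/
theorem contDiff_rhoHat [IsManifold I ∞ M] [I.Boundaryless] [T2Space M] [FiniteDimensional ℝ E']
    (p : ι) : ContDiff ℝ ∞ (P.rhoHat p) := by
  refine contDiff_iff_contDiffAt.2 fun y ↦ ?_
  by_cases hy : y ∈ (P.chart p).target
  · have h := (P.contDiffOn_rho_comp_inv p p).contDiffAt ((P.chart p).isOpen_target.mem_nhds hy)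
    refine h.congr_of_eventuallyEq ?_
    filter_upwards [(P.chart p).isOpen_target.mem_nhds hy] with y₁ hy₁
    exact P.rhoHat_of_mem p hy₁
  · -- off the target the function vanishes near `y` (the support is a compact ball inside)
    have hy' : y ∉ closedBall (0 : E') (4 * P.r p) := fun h ↦ hy (P.closedBall_subset p h)
    have hO : IsOpen (closedBall (0 : E') (2 * P.r p))ᶜ := isClosed_closedBall.isOpen_compl
    have hyO : y ∈ (closedBall (0 : E') (2 * P.r p))ᶜ := fun h ↦
      hy' (closedBall_subset_closedBall (by nlinarith [P.r_pos p]) h)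
    refine (contDiffAt_const (c := (0 : ℝ))).congr_of_eventuallyEq ?_
    filter_upwards [hO.mem_nhds hyO] with y₁ hy₁
    exact image_eq_zero_of_notMem_tsupport fun h ↦ hy₁ (P.tsupport_rhoHat_subset p h)

end Cutoffs

end PatchSystem

/-! ### Existence of patch systems on compact manifolds -/

section Existence

/-- The framed chart at `z` with frame `A` recentred so that `z` is mapped to `0`.
[cite: Lee2013, Ch. 1] -/
def FramedChart.centred (I : ModelWithCorners ℝ E H) (A : E ≃L[ℝ] E') (z : M) : FramedChart I M E' where
  z := z
  A := A
  c := -A (extChartAt I z z)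

/-- `FramedChart.centred_map_base`: centred map base. [folklore] -/
theorem FramedChart.centred_map_base (A : E ≃L[ℝ] E') (z : M) :
    (FramedChart.centred I A z).map z = 0 := by
  simp [FramedChart.centred, FramedChart.map_apply]

/-- Around the base point of a recentred framed chart there is a radius `r ≤ δ` with
`closedBall 0 (4r)` in the target. [folklore] -/
theorem FramedChart.exists_radius [I.Boundaryless] (A : E ≃L[ℝ] E') (z : M) {δ : ℝ}
    (hδ : 0 < δ) :
    ∃ r : ℝ, 0 < r ∧ r ≤ δ ∧ closedBall (0 : E') (4 * r) ⊆ (FramedChart.centred I A z).target := by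
  obtain ⟨r₀, hr₀, h⟩ := (FramedChart.centred I A z).exists_closedBall_subset_target
  rw [show (FramedChart.centred I A z).z = z from rfl, FramedChart.centred_map_base] at h
  refine ⟨min δ (r₀ / 4), lt_min hδ (by linarith), min_le_left _ _, ?_⟩
  refine (closedBall_subset_closedBall ?_).trans h
  linarith [min_le_right δ (r₀ / 4)]

/-- **Existence of patch systems**: on a compact boundaryless manifold, for every family of
frames `A : M → (E ≃L[ℝ] E')` and every positive fineness function `δ`, there is a patch system
whose charts are recentred framed charts `centred I (A z) z` at finitely many points `z`, with
radii `rₚ ≤ δ zₚ`. [cite: Lee2013, Thm. 2.23] -/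
theorem exists_patchSystem [CompactSpace M] [I.Boundaryless] (A : M → (E ≃L[ℝ] E')) (δ : M → ℝ)
    (hδ : ∀ z, 0 < δ z) :
    ∃ t : Finset M, ∃ P : PatchSystem I M E' ↥t,
      ∀ p : ↥t, P.chart p = FramedChart.centred I (A p) (p : M) ∧ P.r p ≤ δ p := by
  classical
  -- radii
  choose r hr hrδ hrt using fun z ↦ FramedChart.exists_radius (I := I) (A z) z (hδ z)
  -- the open cover by inner regions
  set U : M → Set M := fun z ↦ (FramedChart.centred I (A z) z).source ∩
    (FramedChart.centred I (A z) z).map ⁻¹' ball (0 : E') (r z) with hU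
  have hUo : ∀ z, IsOpen (U z) := fun z ↦
    (FramedChart.centred I (A z) z).isOpen_source_inter_preimage isOpen_ball
  have hUz : ∀ z, z ∈ U z := fun z ↦
    ⟨(FramedChart.centred I (A z) z).mem_source, by
      rw [mem_preimage, FramedChart.centred_map_base]; exact mem_ball_self (hr z)⟩
  obtain ⟨t, ht⟩ := isCompact_univ.elim_finite_subcover U hUo fun x _ ↦ mem_iUnion.2 ⟨x, hUz x⟩
  refine ⟨t, ⟨fun p ↦ FramedChart.centred I (A p) (p : M), fun p ↦ r p, fun p ↦ hr p, fun p ↦ hrt p,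
    fun x ↦ ?_⟩, fun p ↦ ⟨rfl, hrδ p⟩⟩
  obtain ⟨z, hz⟩ := mem_iUnion.1 (ht (mem_univ x))
  obtain ⟨hzt, hxz⟩ := mem_iUnion.1 hz
  exact ⟨⟨z, hzt⟩, hxz.1, hxz.2⟩

end Existence


end Literature.Geometry.Manifold

end
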